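import Summits.QuantumFields.QCD.Theorems.HeatSlicedQuarksWilsonLichnerowiczInner
import Literature.MathematicalPhysics.QuantumLattice.GrassmannIntegralProofs

/-!
# Wilson–Lichnerowicz bound (stmt-QuantumFields-8874): link transports, gamma matrices, curvature

`T_μ T_μ† = T_μ† T_μ = 1`, adjointness `⟨w, T_μ u⟩ = ⟨T_μ† w, u⟩`, isometry, commutation with
spin matrices; the gamma-matrix facts on quark fields (self-adjoint, anticommuting, isometric;
from the tree's `euclideanGamma_isHermitian`, `euclideanGamma_mul_self`,
`euclideanGamma_mul_of_ne`); commutators of transports are transports by `A - B` with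
`Σ_{ab} |(A-B)_{ab}|² = 6 - 2 Re tr(A B⁻¹)` for `A, B ∈ SU(3)`; domination of single plaquette
weights by the potential `curv` and the charge-to-`phi` lemma; and the **commutator unit bound**
`‖⟨w, [X,Y] v⟩‖ ≤ 3√2 · phi U v` (`norm_ip_comm_le`).  Mathlib + the tree only, no named facts.
-/

noncomputable section

namespace Summit.QuantumFields.QCD.Theorems.WilsonLichnerowicz

open Literature.Probability.LatticeModels Matrix
open scoped ComplexConjugate

variable {L : ℕ}

/-! ## Link transports of an `SU(3)` lattice gauge field -/

section Links

open Literature.MathematicalPhysics.QuantumLattice Literature.MathematicalPhysics.QuantumFieldTheory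


/-- Unitarity of `SU(3)` matrices: `gᴴ g = 1`. -/
theorem su3_conjTranspose_mul_self (g : SU3) :
    (g : Matrix (Fin 3) (Fin 3) ℂ)ᴴ * (g : Matrix (Fin 3) (Fin 3) ℂ) = 1 := by
  have h := g.prop.1.1
  rwa [Matrix.star_eq_conjTranspose] at h

/-- Unitarity of `SU(3)` matrices: `g gᴴ = 1`. -/
theorem su3_mul_conjTranspose_self (g : SU3) :
    (g : Matrix (Fin 3) (Fin 3) ℂ) * (g : Matrix (Fin 3) (Fin 3) ℂ)ᴴ = 1 := by
  have h := g.prop.1.2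
  rwa [Matrix.star_eq_conjTranspose] at h

/-- The inverse in `SU(3)` is the conjugate transpose. -/
theorem su3_coe_inv (g : SU3) :
    (((g⁻¹ : SU3)) : Matrix (Fin 3) (Fin 3) ℂ) = (g : Matrix (Fin 3) (Fin 3) ℂ)ᴴ := rfl

/-- `T_μ T_μ† = 1`. -/
theorem fwd_bwd (U : GaugeConfig 4 L SU3) (μ : Fin 4) (u : Fld L) : fwd U μ (bwd U μ u) = u := by
  unfold fwd bwd
  rw [transport_transport]
  have h : ∀ x : TorusSite 4 L,
      ((U (x, μ) : SU3) : Matrix (Fin 3) (Fin 3) ℂ) *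
          (((U (x + Pi.single μ 1 - Pi.single μ 1, μ))⁻¹ : SU3) : Matrix (Fin 3) (Fin 3) ℂ) = 1 := by
    intro x
    rw [add_sub_cancel_right, su3_coe_inv, su3_mul_conjTranspose_self]
  rw [transport_congr h (add_neg_cancel (Pi.single μ (1 : ZMod L))), transport_one_zero]

/-- `T_μ† T_μ = 1`. -/
theorem bwd_fwd (U : GaugeConfig 4 L SU3) (μ : Fin 4) (u : Fld L) : bwd U μ (fwd U μ u) = u := by
  unfold fwd bwd
  rw [transport_transport]
  have h : ∀ x : TorusSite 4 L,
      (((U (x - Pi.single μ 1, μ))⁻¹ : SU3) : Matrix (Fin 3) (Fin 3) ℂ) *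
          ((U (x + -Pi.single μ 1, μ) : SU3) : Matrix (Fin 3) (Fin 3) ℂ) = 1 := by
    intro x
    rw [← sub_eq_add_neg, su3_coe_inv, su3_conjTranspose_mul_self]
  rw [transport_congr h (neg_add_cancel (Pi.single μ (1 : ZMod L))), transport_one_zero]

/-- Spin matrices commute with `T_μ`. -/
theorem spin_fwd (Γ : Matrix (Fin 4) (Fin 4) ℂ) (U : GaugeConfig 4 L SU3) (μ : Fin 4) (u : Fld L) :
    spin Γ (fwd U μ u) = fwd U μ (spin Γ u) :=
  spin_transport Γ _ _ u

/-- Spin matrices commute with `T_μ†`. -/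
theorem spin_bwd (Γ : Matrix (Fin 4) (Fin 4) ℂ) (U : GaugeConfig 4 L SU3) (μ : Fin 4) (u : Fld L) :
    spin Γ (bwd U μ u) = bwd U μ (spin Γ u) :=
  spin_transport Γ _ _ u

/-- `|T_μ u|²(x) = |u|²(x + μ̂)`. -/
theorem siteSq_fwd (U : GaugeConfig 4 L SU3) (μ : Fin 4) (u : Fld L) (x : TorusSite 4 L) :
    siteSq (fwd U μ u) x = siteSq u (x + Pi.single μ 1) :=
  siteSq_transport _ _ (fun x => su3_conjTranspose_mul_self (U (x, μ))) u x

variable [NeZero L]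

/-- `⟨w, T_μ u⟩ = ⟨T_μ† w, u⟩`. -/
theorem ip_fwd (U : GaugeConfig 4 L SU3) (μ : Fin 4) (w u : Fld L) :
    ip w (fwd U μ u) = ip (bwd U μ w) u := by
  unfold fwd bwd
  rw [ip_transport]
  rfl

/-- `⟨w, T_μ† u⟩ = ⟨T_μ w, u⟩`. -/
theorem ip_bwd (U : GaugeConfig 4 L SU3) (μ : Fin 4) (w u : Fld L) :
    ip w (bwd U μ u) = ip (fwd U μ w) u := by
  unfold fwd bwd
  rw [ip_transport]
  congr 1
  have h := transport_congr (L := L)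
    (G := fun x => ((((U (x - -Pi.single μ 1 - Pi.single μ 1, μ))⁻¹ : SU3) :
      Matrix (Fin 3) (Fin 3) ℂ))ᴴ)
    (G' := fun x => ((U (x, μ) : SU3) : Matrix (Fin 3) (Fin 3) ℂ)) (fun x => by
      rw [sub_neg_eq_add, add_sub_cancel_right, su3_coe_inv, Matrix.conjTranspose_conjTranspose])
    (neg_neg (Pi.single μ (1 : ZMod L)))
  rw [h]

/-- `T_μ` is an isometry. -/
theorem nsq_fwd (U : GaugeConfig 4 L SU3) (μ : Fin 4) (u : Fld L) : nsq (fwd U μ u) = nsq u :=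
  nsq_transport _ _ (fun x => su3_conjTranspose_mul_self (U (x, μ))) u

/-- `T_μ†` is an isometry. -/
theorem nsq_bwd (U : GaugeConfig 4 L SU3) (μ : Fin 4) (u : Fld L) : nsq (bwd U μ u) = nsq u :=
  nsq_transport _ _ (fun _ => su3_conjTranspose_mul_self _) u

end Links

/-! ## Gamma matrices on quark fields -/

section Gamma

open Literature.MathematicalPhysics.QuantumLattice

/-- `γ_μ` is self-adjoint on quark fields. -/
theorem ip_gamma [NeZero L] (μ : Fin 4) (w u : Fld L) :
    ip w (spin (euclideanGamma μ) u) = ip (spin (euclideanGamma μ) w) u := by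
  rw [ip_spin, (euclideanGamma_isHermitian μ).eq]

/-- Distinct gamma matrices anticommute on quark fields. -/
theorem gamma_anticomm {μ ν : Fin 4} (h : μ ≠ ν) (u : Fld L) :
    spin (euclideanGamma μ) (spin (euclideanGamma ν) u) =
      -spin (euclideanGamma ν) (spin (euclideanGamma μ) u) := by
  rw [spin_spin, spin_spin, euclideanGamma_mul_of_ne h, spin_neg]

/-- `γ_μ` preserves the site norms. -/
theorem siteSq_gamma (μ : Fin 4) (u : Fld L) (x : TorusSite 4 L) :
    siteSq (spin (euclideanGamma μ) u) x = siteSq u x :=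
  siteSq_spin _ (by rw [(euclideanGamma_isHermitian μ).eq, euclideanGamma_mul_self]) u x

/-- `γ_μ` is an isometry of `ℓ²`. -/
theorem nsq_gamma [NeZero L] (μ : Fin 4) (u : Fld L) : nsq (spin (euclideanGamma μ) u) = nsq u :=
  nsq_spin _ (by rw [(euclideanGamma_isHermitian μ).eq, euclideanGamma_mul_self]) u

end Gamma

/-! ## Commutators of transports and the plaquette curvature -/

section Curvature

open Literature.MathematicalPhysics.QuantumLattice Literature.MathematicalPhysics.QuantumFieldTheory


/-- The commutator of two transports is the transport by the difference of the two path-ordered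
products, with the summed offset. -/
theorem transport_comm (GX GY : TorusSite 4 L → Matrix (Fin 3) (Fin 3) ℂ) (eX eY : TorusSite 4 L)
    (u : Fld L) :
    transport GX eX (transport GY eY u) - transport GY eY (transport GX eX u) =
      transport (fun x => GX x * GY (x + eX) - GY x * GX (x + eY)) (eX + eY) u := by
  rw [transport_transport, transport_transport, add_comm eY eX, transport_sub_transport]

/-- `Σ_{a,b} ‖M_{ab}‖² = Re tr (M Mᴴ)` for a `3 × 3` complex matrix. -/
theorem sum_norm_sq_eq_re_trace (M : Matrix (Fin 3) (Fin 3) ℂ) :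
    ∑ a, ∑ b, ‖M a b‖ ^ 2 = (M * Mᴴ).trace.re := by
  simp only [Matrix.trace, Matrix.diag_apply, Matrix.mul_apply, Matrix.conjTranspose_apply,
    Complex.re_sum, Complex.star_def, Complex.mul_conj, Complex.ofReal_re, Complex.normSq_eq_norm_sq]

/-- Frobenius control of the difference of two `SU(3)` matrices by the plaquette-type trace:
`Σ_{a,b} ‖(A - B)_{ab}‖² = 6 - 2 Re tr (A B⁻¹)`. -/
theorem sum_norm_sq_sub_eq (A B : SU3) :
    ∑ a, ∑ b, ‖((A : Matrix (Fin 3) (Fin 3) ℂ) - (B : Matrix (Fin 3) (Fin 3) ℂ)) a b‖ ^ 2 =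
      6 - 2 * (((A * B⁻¹ : SU3) : Matrix (Fin 3) (Fin 3) ℂ)).trace.re := by
  rw [sum_norm_sq_eq_re_trace, Matrix.conjTranspose_sub, Matrix.sub_mul, Matrix.mul_sub,
    Matrix.mul_sub, su3_mul_conjTranspose_self, su3_mul_conjTranspose_self]
  have hBA : ((B : Matrix (Fin 3) (Fin 3) ℂ) * (A : Matrix (Fin 3) (Fin 3) ℂ)ᴴ).trace.re =
      ((A : Matrix (Fin 3) (Fin 3) ℂ) * (B : Matrix (Fin 3) (Fin 3) ℂ)ᴴ).trace.re := by
    rw [show (B : Matrix (Fin 3) (Fin 3) ℂ) * (A : Matrix (Fin 3) (Fin 3) ℂ)ᴴ =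
        ((A : Matrix (Fin 3) (Fin 3) ℂ) * (B : Matrix (Fin 3) (Fin 3) ℂ)ᴴ)ᴴ by
        rw [Matrix.conjTranspose_mul, Matrix.conjTranspose_conjTranspose],
      Matrix.trace_conjTranspose, Complex.star_def, Complex.conj_re]
  have hAB : ((A * B⁻¹ : SU3) : Matrix (Fin 3) (Fin 3) ℂ) =
      (A : Matrix (Fin 3) (Fin 3) ℂ) * (B : Matrix (Fin 3) (Fin 3) ℂ)ᴴ := rfl
  simp only [Matrix.trace_sub, Complex.sub_re, Matrix.trace_one, Fintype.card_fin, hBA, hAB]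
  norm_num
  ring

/-- Entrywise bound: `‖(A - B)_{ab}‖ ≤ √(6 - 2 Re tr (A B⁻¹))` for `A, B ∈ SU(3)`. -/
theorem norm_sub_entry_le (A B : SU3) (a b : Fin 3) :
    ‖((A : Matrix (Fin 3) (Fin 3) ℂ) - (B : Matrix (Fin 3) (Fin 3) ℂ)) a b‖ ≤
      Real.sqrt (6 - 2 * (((A * B⁻¹ : SU3) : Matrix (Fin 3) (Fin 3) ℂ)).trace.re) := by
  rw [← sum_norm_sq_sub_eq, ← Real.sqrt_sq (norm_nonneg _)]
  refine Real.sqrt_le_sqrt ?_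
  calc ‖((A : Matrix (Fin 3) (Fin 3) ℂ) - (B : Matrix (Fin 3) (Fin 3) ℂ)) a b‖ ^ 2
      ≤ ∑ b', ‖((A : Matrix (Fin 3) (Fin 3) ℂ) - (B : Matrix (Fin 3) (Fin 3) ℂ)) a b'‖ ^ 2 :=
        Finset.single_le_sum (f := fun b' => ‖((A : Matrix (Fin 3) (Fin 3) ℂ) -
          (B : Matrix (Fin 3) (Fin 3) ℂ)) a b'‖ ^ 2) (fun _ _ => by positivity) (Finset.mem_univ b)
    _ ≤ ∑ a', ∑ b', ‖((A : Matrix (Fin 3) (Fin 3) ℂ) - (B : Matrix (Fin 3) (Fin 3) ℂ)) a' b'‖ ^ 2 :=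
        Finset.single_le_sum (f := fun a' => ∑ b', ‖((A : Matrix (Fin 3) (Fin 3) ℂ) -
          (B : Matrix (Fin 3) (Fin 3) ℂ)) a' b'‖ ^ 2)
          (fun _ _ => Finset.sum_nonneg fun _ _ => by positivity) (Finset.mem_univ a)

/-- Traces of `SU(3)` words are invariant under conjugation. -/
theorem trace_conj (g P : SU3) :
    (((g * P * g⁻¹ : SU3)) : Matrix (Fin 3) (Fin 3) ℂ).trace = ((P : SU3) : Matrix (Fin 3) (Fin 3) ℂ).trace := by
  rw [show ((g * P * g⁻¹ : SU3) : Matrix (Fin 3) (Fin 3) ℂ) =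
      (g : Matrix (Fin 3) (Fin 3) ℂ) * ((P : Matrix (Fin 3) (Fin 3) ℂ) * ((g⁻¹ : SU3) : Matrix (Fin 3) (Fin 3) ℂ)) by
      simp only [Submonoid.coe_mul, Matrix.mul_assoc],
    Matrix.trace_mul_comm, Matrix.mul_assoc, ← Submonoid.coe_mul, inv_mul_cancel, Submonoid.coe_one,
    Matrix.mul_one]

variable [NeZero L]

/-- `V(U,x) ≥ 0`. -/
theorem curv_nonneg (U : GaugeConfig 4 L SU3) (x : TorusSite 4 L) : 0 ≤ curv U x :=
  Finset.sum_nonneg fun _ _ => Finset.sum_nonneg fun _ _ => Finset.sum_nonneg fun _ _ =>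
    Real.sqrt_nonneg _

/-- `Φ(U,v) ≥ 0`. -/
theorem phi_nonneg (U : GaugeConfig 4 L SU3) (v : Fld L) : 0 ≤ phi U v :=
  Finset.sum_nonneg fun x _ => mul_nonneg (curv_nonneg U x) (siteSq_nonneg v x)

/-- A single plaquette based within torus distance `3` of `x` is dominated by `V(U,x)`. -/
theorem sqrt_le_curv (U : GaugeConfig 4 L SU3) {x y : TorusSite 4 L} (h : torusDist x y ≤ 3)
    (i j : Fin 4) :
    Real.sqrt (3 - (((plaquetteHolonomy U y i j : SU3)) : Matrix (Fin 3) (Fin 3) ℂ).trace.re) ≤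
      curv U x := by
  unfold curv
  have hy : y ∈ Finset.univ.filter (fun y : TorusSite 4 L => torusDist x y ≤ 3) := by
    simp [h]
  refine le_trans ?_ (Finset.single_le_sum (f := fun y => ∑ μ : Fin 4, ∑ ν : Fin 4,
    Real.sqrt (3 - ((fundamentalRep (Fin 3)) (plaquetteHolonomy U y μ ν)).trace.re))
    (fun _ _ => Finset.sum_nonneg fun _ _ => Finset.sum_nonneg fun _ _ => Real.sqrt_nonneg _) hy)
  refine le_trans ?_ (Finset.single_le_sum (f := fun μ => ∑ ν : Fin 4,
    Real.sqrt (3 - ((fundamentalRep (Fin 3)) (plaquetteHolonomy U y μ ν)).trace.re))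
    (fun _ _ => Finset.sum_nonneg fun _ _ => Real.sqrt_nonneg _) (Finset.mem_univ i))
  exact Finset.single_le_sum (f := fun ν =>
    Real.sqrt (3 - ((fundamentalRep (Fin 3)) (plaquetteHolonomy U y i ν)).trace.re))
    (fun _ _ => Real.sqrt_nonneg _) (Finset.mem_univ j)

/-- Charging a translated plaquette weight to `Φ`: if `‖f - z‖ ≤ 3` on the torus then
`Σ_x √(3 - Re tr U_p(x+z;i,j)) |v|²(x+f) ≤ Φ(U,v)`. -/
theorem sum_sqrt_siteSq_le_phi (U : GaugeConfig 4 L SU3) (v : Fld L) (z f : TorusSite 4 L)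
    (i j : Fin 4) (h : torusNorm (f - z) ≤ 3) :
    ∑ x, Real.sqrt (3 - (((plaquetteHolonomy U (x + z) i j : SU3)) : Matrix (Fin 3) (Fin 3) ℂ).trace.re) *
        siteSq v (x + f) ≤ phi U v := by
  unfold phi
  rw [← Fintype.sum_equiv (Equiv.subRight f)
    (fun y => Real.sqrt (3 - (((plaquetteHolonomy U (y - f + z) i j : SU3)) :
      Matrix (Fin 3) (Fin 3) ℂ).trace.re) * siteSq v y) _ (fun y => by
        simp only [Equiv.subRight_apply, sub_add_cancel])]
  refine Finset.sum_le_sum fun y _ => mul_le_mul_of_nonneg_right ?_ (siteSq_nonneg v y)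
  refine sqrt_le_curv U ?_ i j
  show torusNorm (y - (y - f + z)) ≤ 3
  rwa [show y - (y - f + z) = f - z by abel]

/-- **Commutator unit bound.**  Let `X = T_{GX,eX}`, `Y = T_{GY,eY}` be link transports whose
commutator field `GX(x)GY(x+eX) (GY(x)GX(x+eY))⁻¹` has the trace of the plaquette based at `x + z`,
and let `w` have the site norms of `v` translated by `t`.  If `‖t - z‖ ≤ 3` and
`‖eX + eY - z‖ ≤ 3`, then `‖⟨w, [X,Y] v⟩‖ ≤ 3√2 · Φ(U,v)`. -/
theorem norm_ip_comm_le (U : GaugeConfig 4 L SU3) (GX GY : TorusSite 4 L → SU3)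
    (eX eY z t : TorusSite 4 L) (i j : Fin 4)
    (hP : ∀ x, (((GX x * GY (x + eX) * (GY x * GX (x + eY))⁻¹ : SU3)) : Matrix (Fin 3) (Fin 3) ℂ).trace.re =
      (((plaquetteHolonomy U (x + z) i j : SU3)) : Matrix (Fin 3) (Fin 3) ℂ).trace.re)
    (w v : Fld L) (hw : ∀ x, siteSq w x = siteSq v (x + t))
    (ht : torusNorm (t - z) ≤ 3) (he : torusNorm (eX + eY - z) ≤ 3) :
    ‖ip w (transport (fun x => (GX x : Matrix (Fin 3) (Fin 3) ℂ)) eX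
        (transport (fun x => (GY x : Matrix (Fin 3) (Fin 3) ℂ)) eY v) -
      transport (fun x => (GY x : Matrix (Fin 3) (Fin 3) ℂ)) eY
        (transport (fun x => (GX x : Matrix (Fin 3) (Fin 3) ℂ)) eX v))‖ ≤
      3 * Real.sqrt 2 * phi U v := by
  rw [transport_comm]
  have hG : ∀ x a b, ‖((GX x : Matrix (Fin 3) (Fin 3) ℂ) * (GY (x + eX) : Matrix (Fin 3) (Fin 3) ℂ) -
      (GY x : Matrix (Fin 3) (Fin 3) ℂ) * (GX (x + eY) : Matrix (Fin 3) (Fin 3) ℂ)) a b‖ ≤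
      Real.sqrt 2 * Real.sqrt (3 - (((plaquetteHolonomy U (x + z) i j : SU3)) :
        Matrix (Fin 3) (Fin 3) ℂ).trace.re) := by
    intro x a b
    have h := norm_sub_entry_le (GX x * GY (x + eX)) (GY x * GX (x + eY)) a b
    rw [hP x] at h
    refine h.trans_eq ?_
    rw [← Real.sqrt_mul (by norm_num : (0 : ℝ) ≤ 2)]
    congr 1
    ring
  refine (norm_ip_transport_le _ _ _ hG w v).trans ?_
  have h1 := sum_sqrt_siteSq_le_phi U v z t i j ht
  have h2 := sum_sqrt_siteSq_le_phi U v z (eX + eY) i j he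
  have hs2 : 0 ≤ Real.sqrt 2 := Real.sqrt_nonneg 2
  have hsum : ∑ x, Real.sqrt 2 * Real.sqrt (3 - (((plaquetteHolonomy U (x + z) i j : SU3)) :
        Matrix (Fin 3) (Fin 3) ℂ).trace.re) * (siteSq w x + siteSq v (x + (eX + eY))) =
      Real.sqrt 2 * (∑ x, Real.sqrt (3 - (((plaquetteHolonomy U (x + z) i j : SU3)) :
        Matrix (Fin 3) (Fin 3) ℂ).trace.re) * siteSq v (x + t)) +
      Real.sqrt 2 * (∑ x, Real.sqrt (3 - (((plaquetteHolonomy U (x + z) i j : SU3)) :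
        Matrix (Fin 3) (Fin 3) ℂ).trace.re) * siteSq v (x + (eX + eY))) := by
    rw [Finset.mul_sum, Finset.mul_sum, ← Finset.sum_add_distrib]
    exact Finset.sum_congr rfl fun x _ => by rw [hw x]; ring
  rw [hsum]
  have h1' := mul_le_mul_of_nonneg_left h1 hs2
  have h2' := mul_le_mul_of_nonneg_left h2 hs2
  linarith

end Curvature


end Summit.QuantumFields.QCD.Theorems.WilsonLichnerowicz
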